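import Summits.MatrixMultiplication.MatrixMultiplication.Theorems.SaturationLadderTransferLawDefect
import Summits.MatrixMultiplication.MatrixMultiplication.Theorems.SaturationLadderLengthFloorCone
import HarnessLib

/-!
# Route `SaturationLadder` — the UNIVERSAL GAUGE: one cone `G_{λ,μ}` per slope, closed under every in-class
operation; the dictionary with uniform ceilings; quantitative exclusion of `SubexpSaturation` witnesses below `λ`
(decomp-mm lens 1 «grading / quantitative ladder», gen 29; route-free helper: imports NO `Theses` file)

Gen 28 (`…LengthFloorCone`) priced the format algebra by ONE floor, `F = G_{log 4, 1 − log 2}`.  The argument never used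
the values `log 4`, `1 − log 2`: for every slope `λ ≥ 0` and level `μ ∈ ℝ` the GAUGE CLASS

  `G_{λ,μ}(a,b,c) :≡ b < a ∧ λ · b/(a−b) ≤ log((a+c)/b) + μ`   (⟺ `b·e^{λb/(a−b)} ≤ e^{μ}(a+c)`, §1)

is closed under Kronecker sums of formats (§2, the perspective gauge `b·e^{λb/x}` is subadditive —
`lengthGauge_subadditive` of gen 28 is already stated for general `λ`), scalings, real homogeneity, it is monotone in
`(λ,μ)` (§2), and it propagates from base to target along the two laws of an exact single-base certificate
(`b·a' ≤ a·b'`, `b·c' ≤ c·b'`, gen 27) and along every certificate of small defect (gen 28 thresholds) (§3);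
`F` is the instance `(log 4, 1 − log 2)` (§4).  In thin coordinates `(1,t,r)` membership is EXACTLY a uniform-ceiling
statement (§5: `G_{λ,μ}(1,t,r) ⟹ λt − μ(1−t) ≤ (1−t)·log((1+r)/t)`, and `λ ≤ (1−t)·log r`, `μ ≥ 0 ⟹ G_{λ,μ}(1,t,r)`;
members with `t ≤ τ` are in `G_{λ,μ}` as soon as `μ ≥ λτ/(1−τ)`), which is the currency of the cell's HULL framework
(`…HullCeiling`: uniform ceilings survive convex hulls; the twin CLASS has ceiling `c₂ = (5 log(5/4) + 3 log 2)/3`).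
§6 is the QUANTITATIVE exclusion asked for by critic g28 r2: if `1/2 ≤ t < 1` and `(1−t)·(log 4 + λ + |μ|) < λ − c`
then every member `(1,t,r)` of `G_{λ,μ}` has `r > e^{c/(1−t)}` — so for every `c < λ` the class supplies no witness of
the crux `SubexpSaturation` (stmt-25909) beyond an explicit `t₀(λ,μ,c) < 1`.  The slope `λ` of the best gauge class
containing a certificate family is its saturation constant; the companion file `…GaugeConeClasses` places every
certificate class of the tree in `G_{c₂−ε, μ(ε)}` and reads off the two-sided constant `c₂`.
Support module beneath stmt-MatrixMultiplication-25909; closes no item; 0 sorry; no definitions; imports only BUILT modules.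
[cite: CoppersmithWinograd1990, §8 (pp. 268–269); AlmanDuanVassilevskaWilliamsXuXuZhou2025, Thm. 3.2 and §3.4;
ChristandlLeGallLysikovZuiddam2020, Thm. 3.10 and Lemma 4.1; LottiRomani1983, §1 (p. 173)]
-/

set_option linter.dupNamespace false

noncomputable section

open scoped BigOperators

namespace Summit.MatrixMultiplication.MatrixMultiplication.Theorems.SaturationLadderGaugeCone

open Literature.Computability.AlgebraicComplexity
open Literature.Barriers.MatrixMultiplication
open Summit.MatrixMultiplication.MatrixMultiplication.Theorems.SaturationLadderLengthFloorCone
  (lengthGauge_subadditive)  -- landed, imported (general `λ ≥ 0`)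
open Summit.MatrixMultiplication.MatrixMultiplication.Theorems.SaturationLadderTransferLawDefect
  (thinness_law_of_smallDefect length_law_of_smallDefect)  -- landed, imported

variable {K : Type} [Field K]

/-! ## 1. The gauge in exponential form -/

/-- Gauge ⟹ exponential form: `λ·b/(a−b) ≤ log((a+c)/b) + μ` ⟹ `b·e^{λb/(a−b)} ≤ e^{μ}(a+c)` (`0 < b`, `0 < a+c`).
[folklore] -/
theorem gauge_expForm {lam μ a b c : ℝ} (hb : 0 < b) (hac : 0 < a + c)
    (h : lam * (b / (a - b)) ≤ Real.log ((a + c) / b) + μ) :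
    b * Real.exp (lam * (b / (a - b))) ≤ Real.exp μ * (a + c) := by
  have hq : 0 < (a + c) / b := div_pos hac hb
  have h1 := Real.exp_le_exp.2 h
  rw [Real.exp_add, Real.exp_log hq] at h1
  have e : b * ((a + c) / b * Real.exp μ) = Real.exp μ * (a + c) := by
    field_simp
  calc b * Real.exp (lam * (b / (a - b))) ≤ b * ((a + c) / b * Real.exp μ) :=
        mul_le_mul_of_nonneg_left h1 hb.le
    _ = Real.exp μ * (a + c) := e

/-- Exponential form ⟹ gauge (`0 < b`, `0 < a+c`). [folklore] -/
theorem gauge_of_expForm {lam μ a b c : ℝ} (hb : 0 < b) (hac : 0 < a + c)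
    (h : b * Real.exp (lam * (b / (a - b))) ≤ Real.exp μ * (a + c)) :
    lam * (b / (a - b)) ≤ Real.log ((a + c) / b) + μ := by
  have hpos : 0 < b * Real.exp (lam * (b / (a - b))) := by positivity
  have h1 := Real.log_le_log hpos h
  rw [Real.log_mul hb.ne' (Real.exp_pos _).ne', Real.log_exp, Real.log_mul (Real.exp_pos _).ne' hac.ne',
    Real.log_exp, Real.log_div hac.ne' hb.ne'] at *
  linarith

/-! ## 2. One cone per slope: sums, scalings, homogeneity, monotonicity -/

/-- **`G_{λ,μ}` is closed under Kronecker sums of formats** (real form): `0 ≤ λ`, `0 < bᵢ < aᵢ`, `0 ≤ cᵢ`.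
The perspective gauge `b·e^{λb/(a−b)}` is subadditive (`lengthGauge_subadditive`) and `e^{μ}(a+c)` is additive.
[cite: CoppersmithWinograd1990, §8 (pp. 268–269); LottiRomani1983, §1 (p. 173)] -/
theorem gaugeReal_add {lam μ a₁ b₁ c₁ a₂ b₂ c₂ : ℝ} (hlam : 0 ≤ lam) (hb₁ : 0 < b₁) (hb₂ : 0 < b₂)
    (hba₁ : b₁ < a₁) (hba₂ : b₂ < a₂) (hc₁ : 0 ≤ c₁) (hc₂ : 0 ≤ c₂)
    (h₁ : lam * (b₁ / (a₁ - b₁)) ≤ Real.log ((a₁ + c₁) / b₁) + μ)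
    (h₂ : lam * (b₂ / (a₂ - b₂)) ≤ Real.log ((a₂ + c₂) / b₂) + μ) :
    lam * ((b₁ + b₂) / ((a₁ + a₂) - (b₁ + b₂))) ≤ Real.log (((a₁ + a₂) + (c₁ + c₂)) / (b₁ + b₂)) + μ := by
  have g₁ := gauge_expForm hb₁ (by linarith) h₁
  have g₂ := gauge_expForm hb₂ (by linarith) h₂
  have sub := lengthGauge_subadditive (b₁ := b₁) (b₂ := b₂) hlam (by linarith : 0 < a₁ - b₁)
    (by linarith : 0 < a₂ - b₂) hb₁.le hb₂.le
  have e : a₁ - b₁ + (a₂ - b₂) = (a₁ + a₂) - (b₁ + b₂) := by ring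
  rw [e] at sub
  refine gauge_of_expForm (by linarith) (by linarith) ?_
  calc (b₁ + b₂) * Real.exp (lam * ((b₁ + b₂) / ((a₁ + a₂) - (b₁ + b₂))))
      ≤ b₁ * Real.exp (lam * (b₁ / (a₁ - b₁))) + b₂ * Real.exp (lam * (b₂ / (a₂ - b₂))) := sub
    _ ≤ Real.exp μ * (a₁ + c₁) + Real.exp μ * (a₂ + c₂) := add_le_add g₁ g₂
    _ = Real.exp μ * ((a₁ + a₂) + (c₁ + c₂)) := by ring

/-- **Integer formats: `G_{λ,μ}` is closed under sums** (`1 ≤ bᵢ`). [cite: CoppersmithWinograd1990, §8 (pp. 268–269)] -/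
theorem gauge_add {lam μ : ℝ} {a₁ b₁ c₁ a₂ b₂ c₂ : ℕ} (hlam : 0 ≤ lam) (hb₁ : 1 ≤ b₁) (hb₂ : 1 ≤ b₂)
    (h₁ : b₁ < a₁ ∧ lam * ((b₁ : ℝ) / ((a₁ : ℝ) - b₁)) ≤ Real.log (((a₁ : ℝ) + c₁) / b₁) + μ)
    (h₂ : b₂ < a₂ ∧ lam * ((b₂ : ℝ) / ((a₂ : ℝ) - b₂)) ≤ Real.log (((a₂ : ℝ) + c₂) / b₂) + μ) :
    b₁ + b₂ < a₁ + a₂ ∧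
      lam * (((b₁ + b₂ : ℕ) : ℝ) / (((a₁ + a₂ : ℕ) : ℝ) - ((b₁ + b₂ : ℕ) : ℝ))) ≤
        Real.log ((((a₁ + a₂ : ℕ) : ℝ) + ((c₁ + c₂ : ℕ) : ℝ)) / ((b₁ + b₂ : ℕ) : ℝ)) + μ := by
  refine ⟨by omega, ?_⟩
  have hb₁R : (0 : ℝ) < b₁ := by exact_mod_cast hb₁
  have hb₂R : (0 : ℝ) < b₂ := by exact_mod_cast hb₂
  have hba₁ : (b₁ : ℝ) < a₁ := by exact_mod_cast h₁.1
  have hba₂ : (b₂ : ℝ) < a₂ := by exact_mod_cast h₂.1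
  have := gaugeReal_add hlam hb₁R hb₂R hba₁ hba₂ (Nat.cast_nonneg c₁) (Nat.cast_nonneg c₂) h₁.2 h₂.2
  push_cast
  exact this

/-- **Real homogeneity**: `G_{λ,μ}(a,b,c) ⟺ G_{λ,μ}(sa,sb,sc)` for `s > 0` (Kronecker powers; passage to thin
coordinates `s = 1/a`). [folklore] -/
theorem gaugeReal_smul {lam μ a b c s : ℝ} (hs : 0 < s) :
    lam * (b / (a - b)) ≤ Real.log ((a + c) / b) + μ ↔
      lam * ((s * b) / (s * a - s * b)) ≤ Real.log ((s * a + s * c) / (s * b)) + μ := by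
  have e1 : (s * b) / (s * a - s * b) = b / (a - b) := by
    rw [← mul_sub, mul_div_mul_left _ _ hs.ne']
  have e2 : (s * a + s * c) / (s * b) = (a + c) / b := by
    rw [← mul_add, mul_div_mul_left _ _ hs.ne']
  rw [e1, e2]

/-- Integer scaling `(a,b,c) ↦ (na,nb,nc)`, `n ≥ 1`. [folklore] -/
theorem gauge_smul {lam μ : ℝ} {a b c : ℕ} (n : ℕ) (hn : 1 ≤ n)
    (h : b < a ∧ lam * ((b : ℝ) / ((a : ℝ) - b)) ≤ Real.log (((a : ℝ) + c) / b) + μ) :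
    n * b < n * a ∧
      lam * (((n * b : ℕ) : ℝ) / (((n * a : ℕ) : ℝ) - ((n * b : ℕ) : ℝ))) ≤
        Real.log ((((n * a : ℕ) : ℝ) + ((n * c : ℕ) : ℝ)) / ((n * b : ℕ) : ℝ)) + μ := by
  refine ⟨Nat.mul_lt_mul_of_pos_left h.1 (by omega), ?_⟩
  have hnR : (0 : ℝ) < n := by exact_mod_cast hn
  push_cast
  exact (gaugeReal_smul hnR).1 h.2

/-- **Monotonicity in the parameters**: `λ' ≤ λ`, `μ ≤ μ'` ⟹ `G_{λ,μ} ⊆ G_{λ',μ'}` (on `0 < b < a`). [folklore] -/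
theorem gauge_mono {lam lam' μ μ' a b c : ℝ} (hlam : lam' ≤ lam) (hμ : μ ≤ μ') (hb : 0 < b) (hba : b < a)
    (h : lam * (b / (a - b)) ≤ Real.log ((a + c) / b) + μ) :
    lam' * (b / (a - b)) ≤ Real.log ((a + c) / b) + μ' := by
  have hκ : 0 ≤ b / (a - b) := div_nonneg hb.le (by linarith)
  nlinarith [mul_le_mul_of_nonneg_right hlam hκ]

/-! ## 3. Propagation along exact laws and along certificates of small defect -/

/-- **`G_{λ,μ}` propagates from base to target along the laws of an exact transfer** (`b·a' ≤ a·b'`,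
`b·c' ≤ c·b'`; gen 27 `exact_thinness_law`, `exact_length_law`): `κ = b/(a−b)` can only fall, `(a+c)/b` only grow.
[cite: ChristandlLeGallLysikovZuiddam2020, Thm. 3.10 and Lemma 4.1] -/
theorem gauge_transfer {lam μ : ℝ} {a b c a' b' c' : ℕ} (hlam : 0 ≤ lam) (hb : 1 ≤ b) (hb' : 1 ≤ b')
    (hab' : b' < a') (hthin : b * a' ≤ a * b') (hlen : b * c' ≤ c * b')
    (hfloor : lam * ((b' : ℝ) / ((a' : ℝ) - b')) ≤ Real.log (((a' : ℝ) + c') / b') + μ) :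
    b < a ∧ lam * ((b : ℝ) / ((a : ℝ) - b)) ≤ Real.log (((a : ℝ) + c) / b) + μ := by
  have hbR : (1 : ℝ) ≤ b := by exact_mod_cast hb
  have hb'R : (1 : ℝ) ≤ b' := by exact_mod_cast hb'
  have hab'R : (b' : ℝ) + 1 ≤ a' := by exact_mod_cast hab'
  have hthinR : (b : ℝ) * a' ≤ (a : ℝ) * b' := by exact_mod_cast hthin
  have hlenR : (b : ℝ) * c' ≤ (c : ℝ) * b' := by exact_mod_cast hlen
  have hba : b < a := by
    by_contra hle
    have hleR : (a : ℝ) ≤ b := by exact_mod_cast (not_lt.1 hle)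
    nlinarith
  have hbaR : (b : ℝ) + 1 ≤ a := by exact_mod_cast hba
  refine ⟨hba, ?_⟩
  have hd : (0 : ℝ) < (a : ℝ) - b := by linarith
  have hd' : (0 : ℝ) < (a' : ℝ) - b' := by linarith
  have hκ : (b : ℝ) / ((a : ℝ) - b) ≤ (b' : ℝ) / ((a' : ℝ) - b') := by
    rw [div_le_div_iff₀ hd hd']; nlinarith
  have hb0 : (0 : ℝ) < b := by linarith
  have hb'0 : (0 : ℝ) < b' := by linarith
  have hg : ((a' : ℝ) + c') / b' ≤ ((a : ℝ) + c) / b := by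
    rw [div_le_div_iff₀ hb'0 hb0]; nlinarith
  have hg0 : 0 < ((a' : ℝ) + c') / b' := div_pos (by linarith) hb'0
  have hlogg := Real.log_le_log hg0 hg
  nlinarith [mul_le_mul_of_nonneg_left hκ hlam]

/-- **`G_{λ,μ}` propagates along every certificate of small defect** `d·(a'+b') < 2`, `d·(b'+c') < 2` (gen 28: the laws are
open conditions in the defect): a power of the base `⟨p^{a'},p^{b'},p^{c'}⟩` certifying `⟨t⟩ ⊗ ⟨q^a,q^b,q^c⟩` up to `U ≤ a+c+d`.
A base-side catalyst `⟨s⟩` is the case `d = log s / log q`. [cite: ChristandlLeGallLysikovZuiddam2020, Thm. 3.10 and Lemma 4.1] -/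
theorem gauge_of_smallDefect {lam μ : ℝ} {p a' b' c' N t q a b c : ℕ} {d : ℝ} (hp : 2 ≤ p) (hq : 2 ≤ q)
    (ht : 1 ≤ t)
    (h : PolyDegeneratesTo (kroneckerPow (matMulTensor K (p ^ a') (p ^ b') (p ^ c')) N)
      (kroneckerTensor (unitTensor K t) (matMulTensor K (q ^ a) (q ^ b) (q ^ c))))
    (hac : 1 ≤ a + c)
    (hU : ((N : ℝ) * (omegaRect K a' b' c' * Real.log p) - Real.log t) / Real.log q ≤ ((a + c : ℕ) : ℝ) + d)
    (hlam : 0 ≤ lam) (hb : 1 ≤ b) (hb' : 1 ≤ b') (hab' : b' < a') (hbc' : b' ≤ c')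
    (hd₂ : d * ((a' : ℝ) + b') < 2) (hd₃ : d * ((b' : ℝ) + c') < 2)
    (hfloor : lam * ((b' : ℝ) / ((a' : ℝ) - b')) ≤ Real.log (((a' : ℝ) + c') / b') + μ) :
    b < a ∧ lam * ((b : ℝ) / ((a : ℝ) - b)) ≤ Real.log (((a : ℝ) + c) / b) + μ :=
  gauge_transfer hlam hb hb' hab' (thinness_law_of_smallDefect hp hq ht h hac hU hab'.le hd₂)
    (length_law_of_smallDefect hp hq ht h hac hU hbc' hd₃) hfloor

/-! ## 4. Gen 28's floor `F` is the gauge class `(log 4, 1 − log 2)`; `F ⊆ G_{λ,μ}` for `λ ≤ log 4 ≤ …` -/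

/-- `F(a,b,c) ⟺ G_{log 4, 1 − log 2}(a,b,c)` (same inequality, regrouped). [folklore] -/
theorem lengthFloor_iff_gauge {a b c : ℝ} :
    Real.log 4 * (b / (a - b)) ≤ Real.log ((a + c) / b) + 1 - Real.log 2 ↔
      Real.log 4 * (b / (a - b)) ≤ Real.log ((a + c) / b) + (1 - Real.log 2) := by
  rw [add_sub_assoc]

/-- **Every member of gen 28's floor class is in `G_{λ,μ}` for all `λ ≤ log 4`, `μ ≥ 1 − log 2`** (integer formats): so the
X-perfect catalogue (`xPerfect_lengthFloor`), the near-square family (`lengthFloor_nearSquare`) and the sporadic tight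
formats enter every gauge class of slope `≤ log 4`. [cite: CoppersmithWinograd1990, §8 (pp. 268–269)] -/
theorem gauge_of_lengthFloor {lam μ : ℝ} {a b c : ℕ} (hlam : lam ≤ Real.log 4) (hμ : 1 - Real.log 2 ≤ μ)
    (hb : 1 ≤ b)
    (h : b < a ∧ Real.log 4 * ((b : ℝ) / ((a : ℝ) - b)) ≤ Real.log (((a : ℝ) + c) / b) + 1 - Real.log 2) :
    b < a ∧ lam * ((b : ℝ) / ((a : ℝ) - b)) ≤ Real.log (((a : ℝ) + c) / b) + μ := by
  refine ⟨h.1, ?_⟩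
  have hbR : (0 : ℝ) < b := by exact_mod_cast hb
  have hbaR : (b : ℝ) < a := by exact_mod_cast h.1
  exact gauge_mono hlam hμ hbR hbaR (lengthFloor_iff_gauge.1 h.2)

/-! ## 5. Thin coordinates: the gauge IS a uniform ceiling -/

/-- Thin coordinates: for `a > 0`, `G_{λ,μ}(a,b,c) ⟺ G_{λ,μ}(1, b/a, c/a)` written with `t = b/a`, `r = c/a`:
`λ·t/(1−t) ≤ log((1+r)/t) + μ`. [folklore] -/
theorem gauge_thin_iff {lam μ a b c : ℝ} (ha : 0 < a) :
    lam * (b / (a - b)) ≤ Real.log ((a + c) / b) + μ ↔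
      lam * ((b / a) / (1 - b / a)) ≤ Real.log ((1 + c / a) / (b / a)) + μ := by
  have h := gaugeReal_smul (lam := lam) (μ := μ) (a := a) (b := b) (c := c) (s := 1 / a) (by positivity)
  have e1 : 1 / a * a = 1 := by field_simp
  have e2 : 1 / a * b = b / a := by ring
  have e3 : 1 / a * c = c / a := by ring
  rw [e1, e2, e3] at h
  exact h

/-- **Gauge ⟹ ceiling**: `G_{λ,μ}(1,t,r)` with `0 < t < 1` gives `λt − μ(1−t) ≤ (1−t)·log((1+r)/t)`; as `t → 1` the
members of one gauge class have `(1−t) log r ≳ λ`: the slope is a uniform ceiling in the sense of `…HullCeiling`. [folklore] -/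
theorem gauge_ceiling_of {lam μ t r : ℝ} (ht1 : t < 1)
    (h : lam * (t / (1 - t)) ≤ Real.log ((1 + r) / t) + μ) :
    lam * t - μ * (1 - t) ≤ (1 - t) * Real.log ((1 + r) / t) := by
  have hs : 0 < 1 - t := by linarith
  have := mul_le_mul_of_nonneg_left h hs.le
  have e : (1 - t) * (lam * (t / (1 - t))) = lam * t := by field_simp
  rw [e] at this
  linarith

/-- **Ceiling ⟹ gauge**: `0 ≤ λ ≤ (1−t)·log r`, `0 < t < 1`, `0 < r`, `0 ≤ μ` ⟹ `G_{λ,μ}(1,t,r)` (`λt ≤ λ` and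
`log r ≤ log((1+r)/t)`). [folklore] -/
theorem gauge_of_ceiling {lam μ t r : ℝ} (hlam : 0 ≤ lam) (ht0 : 0 < t) (ht1 : t < 1) (hr : 0 < r) (hμ : 0 ≤ μ)
    (h : lam ≤ (1 - t) * Real.log r) :
    lam * (t / (1 - t)) ≤ Real.log ((1 + r) / t) + μ := by
  have hs : 0 < 1 - t := by linarith
  have hq : r ≤ (1 + r) / t := by
    rw [le_div_iff₀ ht0]; nlinarith
  have hlog : Real.log r ≤ Real.log ((1 + r) / t) := Real.log_le_log hr hq
  have h1 : lam * (t / (1 - t)) ≤ lam / (1 - t) := by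
    rw [mul_div_assoc']
    exact div_le_div_of_nonneg_right (by nlinarith) hs.le
  have h2 : lam / (1 - t) ≤ Real.log r := by
    rw [div_le_iff₀ hs]; linarith
  linarith

/-- **Members of small thinness are in every gauge class of large enough level**: `0 < t ≤ τ < 1`, `0 ≤ r`,
`μ ≥ λτ/(1−τ)` ⟹ `G_{λ,μ}(1,t,r)` (`log((1+r)/t) ≥ 0`). [folklore] -/
theorem gauge_of_small_t {lam μ t r τ : ℝ} (hlam : 0 ≤ lam) (ht0 : 0 < t) (htτ : t ≤ τ) (hτ : τ < 1) (hr : 0 ≤ r)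
    (hμ : lam * (τ / (1 - τ)) ≤ μ) :
    lam * (t / (1 - t)) ≤ Real.log ((1 + r) / t) + μ := by
  have hs : 0 < 1 - t := by linarith
  have hsτ : 0 < 1 - τ := by linarith
  have hκ : t / (1 - t) ≤ τ / (1 - τ) := by
    rw [div_le_div_iff₀ hs hsτ]; nlinarith
  have hq : 1 ≤ (1 + r) / t := by
    rw [le_div_iff₀ ht0]; linarith
  have hlog : 0 ≤ Real.log ((1 + r) / t) := Real.log_nonneg hq
  nlinarith [mul_le_mul_of_nonneg_left hκ hlam]

/-! ## 6. Quantitative exclusion of `SubexpSaturation` witnesses below the slope -/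

/-- **Quantitative exclusion** (critic g28 r2).  If `c < λ`, `1/2 ≤ t < 1`, `(1−t)·(log 4 + λ + |μ|) < λ − c` and
`(1,t,r) ∈ G_{λ,μ}` with `r > 0`, then `r > e^{c/(1−t)}`: the member is NOT a witness of the `SubexpSaturation` clause at
rate `c`.  (Exponential form `t·e^{λt/(1−t)} ≤ e^{μ}(1+r)`, and `λt/(1−t) = (λ−c)/(1−t) + c/(1−t) − λ`.) [folklore] -/
theorem gauge_excludes_witness {lam μ c t r : ℝ} (hc : 0 ≤ c) (ht : 1 / 2 ≤ t) (ht1 : t < 1)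
    (hclose : (1 - t) * (Real.log 4 + lam + |μ|) < lam - c) (hr : 0 < r)
    (h : lam * (t / (1 - t)) ≤ Real.log ((1 + r) / t) + μ) :
    Real.exp (c / (1 - t)) < r := by
  have hs : 0 < 1 - t := by linarith
  have ht0 : 0 < t := by linarith
  have g := gauge_expForm (a := 1) (b := t) (c := r) ht0 (by linarith) h
  -- split the exponent
  have e1 : lam * (t / (1 - t)) = (lam - c) / (1 - t) + c / (1 - t) - lam := by
    field_simp; ring
  rw [e1, Real.exp_sub, Real.exp_add] at g
  -- `(λ−c)/(1−t) > log 4 + λ + μ`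
  have hμ : μ ≤ |μ| := le_abs_self μ
  have hbig : Real.log 4 + lam + μ < (lam - c) / (1 - t) := by
    rw [lt_div_iff₀ hs]
    nlinarith
  have h4 : 4 * Real.exp lam * Real.exp μ < Real.exp ((lam - c) / (1 - t)) := by
    have := Real.exp_lt_exp.2 hbig
    rwa [Real.exp_add, Real.exp_add, Real.exp_log (by norm_num : (0 : ℝ) < 4)] at this
  have hE1 : 1 ≤ Real.exp (c / (1 - t)) := Real.one_le_exp (div_nonneg hc hs.le)
  have hE0 : 0 < Real.exp (c / (1 - t)) := Real.exp_pos _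
  have hL0 : 0 < Real.exp lam := Real.exp_pos _
  have hM0 : 0 < Real.exp μ := Real.exp_pos _
  -- from `g`: `t · e^{(λ−c)/(1−t)} · E / e^{λ} ≤ e^{μ}(1+r)`
  have g' : t * (Real.exp ((lam - c) / (1 - t)) * Real.exp (c / (1 - t))) ≤
      Real.exp μ * (1 + r) * Real.exp lam := by
    have := g
    rw [mul_div_assoc'] at this
    rwa [div_le_iff₀ hL0] at this
  -- hence `2 e^{λ} e^{μ} E < e^{λ} e^{μ} (1 + r)`, i.e. `2E < 1 + r`
  have key : 2 * Real.exp (c / (1 - t)) < 1 + r := by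
    have h1 : t * (Real.exp ((lam - c) / (1 - t)) * Real.exp (c / (1 - t))) >
        (1 / 2) * (4 * Real.exp lam * Real.exp μ) * Real.exp (c / (1 - t)) := by
      have := mul_lt_mul_of_pos_right h4 hE0
      nlinarith [mul_le_mul_of_nonneg_right ht (mul_pos (Real.exp_pos ((lam - c) / (1 - t))) hE0).le]
    have h2 : Real.exp lam * Real.exp μ * (2 * Real.exp (c / (1 - t))) <
        Real.exp lam * Real.exp μ * (1 + r) := by nlinarith
    exact lt_of_mul_lt_mul_left h2 (mul_pos hL0 hM0).le
  linarith

/-- **The gauge class `G_{λ,μ}` supplies no `SubexpSaturation` witness below its slope**: for every `0 < c < λ` there is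
an explicit `t₀ = max(1/2, 1 − (λ−c)/(2(log 4 + λ + |μ|))) < 1` beyond which every member `(1,t,r)`, `r > 0`, has
`r > e^{c/(1−t)}`.  With §§2–3: the closure of any catalogue inside `G_{λ,μ}` under Kronecker sums, scalings, exact and
small-defect single-base transfers stays inside `G_{λ,μ}` — format algebra never lowers a saturation constant.
[cite: CoppersmithWinograd1990, §8 (pp. 268–269); AlmanDuanVassilevskaWilliamsXuXuZhou2025, Thm. 3.2 and §3.4] -/
theorem gaugeClass_excludes_subexp_witness (lam μ c : ℝ) (hc : 0 < c) (hcl : c < lam) :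
    ∃ t₀ : ℝ, t₀ < 1 ∧ ∀ t r : ℝ, t₀ ≤ t → t < 1 → 0 < r →
      lam * (t / (1 - t)) ≤ Real.log ((1 + r) / t) + μ → Real.exp (c / (1 - t)) < r := by
  set M := Real.log 4 + lam + |μ| with hM
  have hl4 : 0 < Real.log 4 := Real.log_pos (by norm_num)
  have hM0 : 0 < M := by have := abs_nonneg μ; rw [hM]; linarith
  set δ := lam - c with hδ
  have hδ0 : 0 < δ := by rw [hδ]; linarith
  refine ⟨max (1 / 2) (1 - δ / (2 * M)), max_lt (by norm_num) (by
    have : 0 < δ / (2 * M) := by positivity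
    linarith), ?_⟩
  intro t r ht0 ht1 hr hG
  have ht12 : 1 / 2 ≤ t := le_trans (le_max_left _ _) ht0
  have htδ : 1 - δ / (2 * M) ≤ t := le_trans (le_max_right _ _) ht0
  refine gauge_excludes_witness hc.le ht12 ht1 ?_ hr hG
  have h1 : 1 - t ≤ δ / (2 * M) := by linarith
  have h2 : (1 - t) * M ≤ δ / (2 * M) * M := mul_le_mul_of_nonneg_right h1 hM0.le
  have h3 : δ / (2 * M) * M = δ / 2 := by field_simp
  linarith

end Summit.MatrixMultiplication.MatrixMultiplication.Theorems.SaturationLadderGaugeCone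

end
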